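import Literature.Analysis.FluidPDE.NSWave0
import Mathlib.Analysis.InnerProductSpace.Laplacian
import Mathlib.MeasureTheory.Measure.Haar.OfBasis
import HarnessLib

/-!
# The parasitic drift solutions `u = b(t)`, `p = −b′(t)·x` in the Clay-type setting WITHOUT the
# energy condition (7) (Koch–Nadirashvili–Seregin–Šverák 2009, §1)

Analysis/FluidPDE file. Koch–Nadirashvili–Seregin–Šverák, *Liouville theorems for the
Navier–Stokes equations and applications*, Acta Math. 203 (2009), §1 (arXiv:0709.3599 p. 3):
"Equation (1.1) has trivial non-constant solutions of the form `u(x,t) = b(t)`,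
`p(x,t) = −b′(t)x` and so we need a definition of solutions which would eliminate these
'parasitic solutions'." In Fefferman's statements (A)/(C) this elimination is done by the bounded
energy condition (7) `∫|u(x,t)|² dx < C`; claimed proofs that type "the solution of the
Navier–Stokes problem with smooth decaying data" as a classical smooth solution on `ℝ³ × [0,∞)`
WITHOUT (7) (delta axis Δ5 of `Literature/Claims/NS/ClayVariants.lean`) quantify over a class that
contains these drifts. This file makes the remark a kernel theorem in the vocabulary of
`NSWave0.lean` (`IsNavierStokesSolution`, `IsSmoothOnHalfSpace`, `HasBoundedEnergy`):

* `driftVelocity b`, `driftPressure b` — `u(t,x) = b(t)`, `p(t,x) = −⟪b′(t), x⟫` for a time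
  profile `b : ℝ → E`;
* `isNavierStokesSolution_drift` — for `b ∈ C¹(ℝ)`, `(u, p)` solves (1)(2)(3) with force `f ≡ 0`
  and datum `x ↦ b(0)`, at EVERY viscosity; `isSmoothOnHalfSpace_driftVelocity/Pressure` — both are
  `C^∞(E × [0,∞))` when `b ∈ C^∞`;
* `lintegral_enorm_sq_driftVelocity` — on `ℝ³`, `∫|u(t)|² = ∞` whenever `b(t) ≠ 0`, so
  `not_hasBoundedEnergy_drift`: (7) fails as soon as `b(t) ≠ 0` for some `t ≥ 0`;
* `exists_parasitic_solution_zero_datum` — **at every viscosity the ZERO datum (smooth,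
  divergence free, rapidly decaying: a Clay datum) admits a smooth solution of (1)(2)(3), `f ≡ 0`,
  on `ℝ³ × [0,∞)` with `∫|u(t)|² = ∞` for every `t > 0`** (`b(t) = t·e₀`); hence
  `not_unique_claySetting_without_energy` (the rest state and the drift are two distinct smooth
  solutions from the same Clay datum) and `not_energyBound_claySetting_without_energy` (the
  "energy inequality" `‖u(t)‖₂ ≤ ‖u₀‖₂` fails in the class without (7)).

For the claims cell (`ns-claims`, D-0090): a step typed over smooth solutions from Clay data
without (7) and asserting uniqueness, an `L²`/energy bound, decay, or equivalence with the
mild/Duhamel formulation in an `L^p` class is refuted by instantiating these lemmas; the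
charitable re-typing adds (7) (or `Literature.Analysis.FluidPDE.HasBoundedEnergy`), after which the
classical statements of the tree apply (energy inequality / Leray–Hopf property of finite-energy
classical solutions, `isLerayHopfOn_of_finiteEnergy`; uniqueness `IsNavierStokesSolution.ae_eq_of_isLerayHopfOn`).

## References

* G. Koch, N. Nadirashvili, G. Seregin, V. Šverák, Acta Math. 203 (2009) 83–105 =
  arXiv:0709.3599, §1 p. 3. [KochNadirashviliSereginSverak2009]
* C. L. Fefferman, *Existence and smoothness of the Navier–Stokes equation*, CMI (2006),
  condition (7). [FeffermanClay2006]
-/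

noncomputable section

open MeasureTheory Set Function
open scoped InnerProductSpace RealInnerProductSpace ENNReal ContDiff Laplacian

namespace Literature.Analysis.FluidPDE

section General

variable {E : Type*} [NormedAddCommGroup E] [InnerProductSpace ℝ E] [FiniteDimensional ℝ E]

/-- The parasitic drift velocity `u(t, x) = b(t)` (spatially constant, time dependent).
[cite: KochNadirashviliSereginSverak2009, §1 (arXiv p. 3)] -/
def driftVelocity (b : ℝ → E) : ℝ → E → E := fun t _ => b t

/-- The parasitic drift pressure `p(t, x) = −⟪b′(t), x⟫` (affine in `x`).
[cite: KochNadirashviliSereginSverak2009, §1 (arXiv p. 3)] -/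
def driftPressure (b : ℝ → E) : ℝ → E → ℝ := fun t x => -⟪deriv b t, x⟫

omit [NormedAddCommGroup E] [InnerProductSpace ℝ E] [FiniteDimensional ℝ E] in
/-- `u(t,x) = b(t)`. [cite: KochNadirashviliSereginSverak2009, §1 (arXiv p. 3)] -/
@[simp] theorem driftVelocity_apply (b : ℝ → E) (t : ℝ) (x : E) : driftVelocity b t x = b t := rfl

omit [FiniteDimensional ℝ E] in
/-- `p(t,x) = −⟪b′(t), x⟫`. [cite: KochNadirashviliSereginSverak2009, §1 (arXiv p. 3)] -/
@[simp] theorem driftPressure_apply (b : ℝ → E) (t : ℝ) (x : E) :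
    driftPressure b t x = -⟪deriv b t, x⟫ := rfl

omit [FiniteDimensional ℝ E] in
/-- The gradient of `y ↦ ⟪c, y⟫` is `c`. [folklore] -/
private theorem gradient_inner_left_const_vector (c x : E) [CompleteSpace E] :
    gradient (fun y => ⟪c, y⟫) x = c := by
  have h : HasFDerivAt (fun y => ⟪c, y⟫) (innerSL ℝ c) x := (innerSL ℝ c).hasFDerivAt
  rw [gradient, h.fderiv]
  apply (InnerProductSpace.toDual ℝ E).injective
  rw [LinearIsometryEquiv.apply_symm_apply]
  ext y
  simp [InnerProductSpace.toDual_apply_apply]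

/-- **The parasitic drift solves the Navier–Stokes system (1)(2)(3) with `f ≡ 0`** at every
viscosity, with datum the constant field `x ↦ b(0)`: `∂ₜu = b′(t) = −∇p`, `(u·∇)u = 0`, `Δu = 0`,
`div u = 0` (KNSS 2009, §1: "trivial non-constant solutions of the form `u(x,t) = b(t)`,
`p(x,t) = −b′(t)x`"). [cite: KochNadirashviliSereginSverak2009, §1 (arXiv p. 3)] -/
theorem isNavierStokesSolution_drift {b : ℝ → E} (hb : ContDiff ℝ 1 b) (ν : ℝ) :
    IsNavierStokesSolution ν 0 (fun _ => b 0) (driftVelocity b) (driftPressure b) where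
  momentum t ht x := by
    haveI : CompleteSpace E := FiniteDimensional.complete ℝ E
    have hd : derivWithin (fun s => driftVelocity b s x) (Ici 0) t = deriv b t :=
      ((hb.differentiable one_ne_zero).differentiableAt.derivWithin (uniqueDiffOn_Ici 0 t ht))
    have hc : fderiv ℝ (driftVelocity b t) x (driftVelocity b t x) = 0 := by
      show fderiv ℝ (fun _ : E => b t) x (b t) = 0
      simp
    have hl : (Δ (driftVelocity b t)) x = 0 := by
      show (Δ (fun _ : E => b t)) x = 0
      rw [InnerProductSpace.laplacian_const]
      rfl
    have hg : gradient (driftPressure b t) x = -deriv b t := by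
      have h1 : driftPressure b t = fun y => ⟪-deriv b t, y⟫ := by
        funext y; simp [inner_neg_left]
      rw [h1, gradient_inner_left_const_vector]
    rw [hd, hc, hl, hg]
    simp
  divFree t ht x := by
    show NSWave0.divergence (fun _ : E => b t) x = 0
    simp [NSWave0.divergence]
  initial := rfl

omit [FiniteDimensional ℝ E] in
/-- The drift velocity is smooth on `E × [0,∞)` when `b ∈ C^∞`.
[cite: KochNadirashviliSereginSverak2009, §1 (arXiv p. 3)] -/
theorem isSmoothOnHalfSpace_driftVelocity {b : ℝ → E} (hb : ContDiff ℝ ∞ b) :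
    IsSmoothOnHalfSpace (driftVelocity b) := by
  have h : uncurry (driftVelocity b) = b ∘ Prod.fst := by
    funext z; rfl
  rw [IsSmoothOnHalfSpace, h]
  exact (hb.comp contDiff_fst).contDiffOn

omit [FiniteDimensional ℝ E] in
/-- The drift pressure is smooth on `E × [0,∞)` when `b ∈ C^∞` (`b′` is smooth and the pairing is
bilinear). [cite: KochNadirashviliSereginSverak2009, §1 (arXiv p. 3)] -/
theorem isSmoothOnHalfSpace_driftPressure {b : ℝ → E} (hb : ContDiff ℝ ∞ b) :
    IsSmoothOnHalfSpace (driftPressure b) := by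
  have hb' : ContDiff ℝ ∞ (deriv b) := hb.deriv'
  have h : uncurry (driftPressure b) = fun z : ℝ × E => -⟪deriv b z.1, z.2⟫ := by
    funext z; rfl
  rw [IsSmoothOnHalfSpace, h]
  exact ((hb'.comp contDiff_fst).inner ℝ contDiff_snd).neg.contDiffOn

end General

/-! ### On `ℝ³`: infinite energy, non-uniqueness and failure of the energy bound without (7) -/

section R3

/-- **A nonzero drift has infinite kinetic energy on `ℝ³`**: `∫ |b(t)|² dx = |b(t)|² · |ℝ³| = ∞`
(the reason (7) excludes it). [cite: KochNadirashviliSereginSverak2009, §1 (arXiv p. 3)] -/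
theorem lintegral_enorm_sq_driftVelocity {b : ℝ → EuclideanSpace ℝ (Fin 3)} {t : ℝ} (hbt : b t ≠ 0) :
    ∫⁻ x, ‖driftVelocity b t x‖ₑ ^ 2 = ⊤ := by
  have hpos : ‖b t‖ₑ ^ 2 ≠ 0 := by simpa using hbt
  calc ∫⁻ x : EuclideanSpace ℝ (Fin 3), ‖driftVelocity b t x‖ₑ ^ 2 = ∫⁻ _ : EuclideanSpace ℝ (Fin 3), ‖b t‖ₑ ^ 2 := rfl
    _ = ‖b t‖ₑ ^ 2 * volume (univ : Set (EuclideanSpace ℝ (Fin 3))) := lintegral_const _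
    _ = ⊤ := by
        rw [measure_univ_of_isAddLeftInvariant]
        exact ENNReal.mul_top hpos

/-- The `L²` norm of a nonzero drift slice is infinite. [cite: KochNadirashviliSereginSverak2009, §1 (arXiv p. 3)] -/
theorem eLpNorm_driftVelocity_eq_top {b : ℝ → EuclideanSpace ℝ (Fin 3)} {t : ℝ} (hbt : b t ≠ 0) :
    eLpNorm (driftVelocity b t) 2 volume = ⊤ := by
  have hpos : ‖b t‖ₑ ≠ 0 := by simpa using hbt
  rw [show driftVelocity b t = fun _ : EuclideanSpace ℝ (Fin 3) => b t from rfl, eLpNorm_const _ two_ne_zero (NeZero.ne _),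
    measure_univ_of_isAddLeftInvariant, ENNReal.top_rpow_of_pos (by norm_num), ENNReal.mul_top hpos]

/-- **The drift violates Fefferman's bounded-energy condition (7)** as soon as `b(t) ≠ 0` at some
`t ≥ 0`. [cite: KochNadirashviliSereginSverak2009, §1 (arXiv p. 3)] -/
theorem not_hasBoundedEnergy_drift {b : ℝ → EuclideanSpace ℝ (Fin 3)} {t : ℝ} (ht : 0 ≤ t) (hbt : b t ≠ 0) :
    ¬ HasBoundedEnergy (driftVelocity b) := by
  rintro ⟨C, hC, h⟩
  have h1 := h t ht
  rw [lintegral_enorm_sq_driftVelocity hbt] at h1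
  exact (lt_irrefl _) ((top_le_iff.1 h1).symm ▸ hC)

/-- The linear time profile `b(t) = t • e₀`: smooth, `b(0) = 0`, `b(t) ≠ 0` for `t ≠ 0`.
[folklore] -/
private theorem contDiff_linearProfile : ContDiff ℝ ∞ (fun t : ℝ => t • EuclideanSpace.single (0 : Fin 3) (1 : ℝ)) :=
  contDiff_id.smul contDiff_const

/-- `t • e₀ ≠ 0` for `t ≠ 0`. [folklore] -/
private theorem linearProfile_ne_zero {t : ℝ} (ht : t ≠ 0) :
    t • EuclideanSpace.single (0 : Fin 3) (1 : ℝ) ≠ 0 := by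
  intro h
  have := congrArg (fun v : EuclideanSpace ℝ (Fin 3) => v 0) h
  simp at this
  exact ht this

/-- The zero datum is a Clay datum: smooth, divergence free, rapidly decaying (Fefferman's (4)).
[cite: FeffermanClay2006, (4) p. 1] -/
theorem clayDatum_zero :
    ContDiff ℝ ∞ (0 : EuclideanSpace ℝ (Fin 3) → EuclideanSpace ℝ (Fin 3)) ∧ NSWave0.IsDivFree (0 : EuclideanSpace ℝ (Fin 3) → EuclideanSpace ℝ (Fin 3)) ∧
      HasRapidSpatialDecay (0 : EuclideanSpace ℝ (Fin 3) → EuclideanSpace ℝ (Fin 3)) := by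
  refine ⟨contDiff_const, fun x => by simp [NSWave0.divergence, Pi.zero_def], fun n K => ⟨0, fun x => ?_⟩⟩
  have : iteratedFDeriv ℝ n (0 : EuclideanSpace ℝ (Fin 3) → EuclideanSpace ℝ (Fin 3)) x = 0 := by
    rw [Pi.zero_def, iteratedFDeriv_fun_zero]; rfl
  rw [this, norm_zero, mul_zero]

/-- **At every viscosity the zero datum admits a smooth, infinite-energy solution of (1)(2)(3)
with `f ≡ 0` on `EuclideanSpace ℝ (Fin 3) × [0,∞)`** — the parasitic drift `u(t,x) = t e₀`, `p(t,x) = −x₀`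
(KNSS 2009, §1). The datum `0` is a Clay datum (`clayDatum_zero`); the solution is smooth on the
closed half-space; its energy is infinite at every `t > 0`. So the class "smooth solution of the
Navier–Stokes problem from smooth rapidly decaying data", WITHOUT Fefferman's condition (7), is
not the class of physical solutions. [cite: KochNadirashviliSereginSverak2009, §1 (arXiv p. 3)] -/
theorem exists_parasitic_solution_zero_datum (ν : ℝ) :
    ∃ (u : ℝ → EuclideanSpace ℝ (Fin 3) → EuclideanSpace ℝ (Fin 3)) (p : ℝ → EuclideanSpace ℝ (Fin 3) → ℝ),
      IsNavierStokesSolution ν 0 0 u p ∧ IsSmoothOnHalfSpace u ∧ IsSmoothOnHalfSpace p ∧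
        (∀ t : ℝ, t ≠ 0 → eLpNorm (u t) 2 volume = ⊤) ∧ ¬ HasBoundedEnergy u := by
  set b : ℝ → EuclideanSpace ℝ (Fin 3) := fun t => t • EuclideanSpace.single (0 : Fin 3) (1 : ℝ) with hb
  have hbs : ContDiff ℝ ∞ b := contDiff_linearProfile
  have h0 : (fun _ : EuclideanSpace ℝ (Fin 3) => b 0) = (0 : EuclideanSpace ℝ (Fin 3) → EuclideanSpace ℝ (Fin 3)) := by
    funext x; simp [hb]
  refine ⟨driftVelocity b, driftPressure b, ?_, isSmoothOnHalfSpace_driftVelocity hbs,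
    isSmoothOnHalfSpace_driftPressure hbs, fun t ht => eLpNorm_driftVelocity_eq_top
      (linearProfile_ne_zero ht), not_hasBoundedEnergy_drift zero_le_one
      (linearProfile_ne_zero one_ne_zero)⟩
  have h := isNavierStokesSolution_drift (hbs.of_le (by exact_mod_cast le_top)) ν
  rwa [h0] at h

/-- **Non-uniqueness in the Clay-type setting without (7)**: at every viscosity there are two
smooth solutions of (1)(2)(3), `f ≡ 0`, on `EuclideanSpace ℝ (Fin 3) × [0,∞)` from the SAME Clay datum (here `0`) that
differ at every positive time (the rest state and the parasitic drift).
[cite: KochNadirashviliSereginSverak2009, §1 (arXiv p. 3)] -/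
theorem not_unique_claySetting_without_energy (ν : ℝ) :
    ∃ (u₀ : EuclideanSpace ℝ (Fin 3) → EuclideanSpace ℝ (Fin 3)) (u v : ℝ → EuclideanSpace ℝ (Fin 3) → EuclideanSpace ℝ (Fin 3)) (p q : ℝ → EuclideanSpace ℝ (Fin 3) → ℝ),
      ContDiff ℝ ∞ u₀ ∧ NSWave0.IsDivFree u₀ ∧ HasRapidSpatialDecay u₀ ∧
      IsNavierStokesSolution ν 0 u₀ u p ∧ IsSmoothOnHalfSpace u ∧ IsSmoothOnHalfSpace p ∧
      IsNavierStokesSolution ν 0 u₀ v q ∧ IsSmoothOnHalfSpace v ∧ IsSmoothOnHalfSpace q ∧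
        ∀ t : ℝ, 0 < t → u t ≠ v t := by
  obtain ⟨v, q, hv, hvs, hqs, htop, -⟩ := exists_parasitic_solution_zero_datum ν
  obtain ⟨h1, h2, h3⟩ := clayDatum_zero
  -- the rest state is the drift with the zero profile
  set b₀ : ℝ → EuclideanSpace ℝ (Fin 3) := fun _ => 0 with hb₀
  have hb₀s : ContDiff ℝ ∞ b₀ := contDiff_const
  have hrest := isNavierStokesSolution_drift (hb₀s.of_le (by exact_mod_cast le_top)) ν
  have hd : (fun _ : EuclideanSpace ℝ (Fin 3) => b₀ 0) = (0 : EuclideanSpace ℝ (Fin 3) → EuclideanSpace ℝ (Fin 3)) := by funext x; rfl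
  rw [hd] at hrest
  refine ⟨0, driftVelocity b₀, v, driftPressure b₀, q, h1, h2, h3, hrest,
    isSmoothOnHalfSpace_driftVelocity hb₀s, isSmoothOnHalfSpace_driftPressure hb₀s, hv, hvs, hqs,
    fun t ht hne => ?_⟩
  have hz : eLpNorm (driftVelocity b₀ t) 2 volume = 0 := by
    rw [show driftVelocity b₀ t = fun _ : EuclideanSpace ℝ (Fin 3) => (0 : EuclideanSpace ℝ (Fin 3)) from rfl]
    simp
  have h := htop t ht.ne'
  rw [← hne, hz] at h
  exact ENNReal.zero_ne_top h

/-- **The energy bound `‖u(t)‖₂ ≤ ‖u₀‖₂` FAILS in the Clay-type setting without (7)**: at every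
viscosity there is a smooth solution of (1)(2)(3), `f ≡ 0`, from a Clay datum with
`‖u(t)‖_{L²} > ‖u₀‖_{L²}` (indeed `= ∞` versus `0`) for every `t > 0`. A step asserting the
energy inequality for ALL smooth solutions from smooth decaying data, with no integrability
class on the solution, is therefore false as typed; with (7) it is the classical energy inequality.
[cite: KochNadirashviliSereginSverak2009, §1 (arXiv p. 3)] -/
theorem not_energyBound_claySetting_without_energy (ν : ℝ) :
    ¬ ∀ (u₀ : EuclideanSpace ℝ (Fin 3) → EuclideanSpace ℝ (Fin 3)) (u : ℝ → EuclideanSpace ℝ (Fin 3) → EuclideanSpace ℝ (Fin 3)) (p : ℝ → EuclideanSpace ℝ (Fin 3) → ℝ),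
        ContDiff ℝ ∞ u₀ → NSWave0.IsDivFree u₀ → HasRapidSpatialDecay u₀ →
        IsNavierStokesSolution ν 0 u₀ u p → IsSmoothOnHalfSpace u → IsSmoothOnHalfSpace p →
        ∀ t : ℝ, 0 ≤ t → eLpNorm (u t) 2 volume ≤ eLpNorm u₀ 2 volume := by
  intro H
  obtain ⟨v, q, hv, hvs, hqs, htop, -⟩ := exists_parasitic_solution_zero_datum ν
  obtain ⟨h1, h2, h3⟩ := clayDatum_zero
  have h := H 0 v q h1 h2 h3 hv hvs hqs 1 zero_le_one
  rw [htop 1 one_ne_zero] at h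
  have hz : eLpNorm (0 : EuclideanSpace ℝ (Fin 3) → EuclideanSpace ℝ (Fin 3)) 2 volume = 0 := by simp
  rw [hz] at h
  exact ENNReal.top_ne_zero (le_antisymm h bot_le)

end R3

end Literature.Analysis.FluidPDE

end
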